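import Summits.AtomisticToContinuum.Crystallization.Theorems.SquareWellLayerCakeGapTwelveToBarlowFiveFoldRing2

/-!
# Five-fold bonds are closed rings — part 3/3: from `2`-regularity to the explicit `5`-cycle

Crux `SquareWellLayerCake.GapTwelveToBarlow` (stmt-AtomisticToContinuum-15807), line `Sketch`.
`cycle_of_two_regular` (a `2`-regular relation on five elements is the `5`-cycle), and the
cyclic enumerations `fiveFold_ring_cycle`, `fiveFold_ring_cycle_of_deep` of the ring of common
neighbours of a five-fold bond (see parts 1–2).  Mathlib + parts 1–2 only.
-/

noncomputable section

namespace Summit.AtomisticToContinuum.Crystallization.Theorems.SquareWellLayerCakeGapTwelveToBarlow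

open scoped InnerProductSpace ComplexConjugate Real

/-! ## From `2`-regularity to the explicit `5`-cycle -/

/-- **A `2`-regular graph on five vertices is a `5`-cycle.**  If every element of a
`5`-element set `S` is related (by a symmetric relation `R`) to exactly two OTHER elements of
`S`, then `S` can be enumerated as `w 0, …, w 4` with `R (w t) (w (t+1))` cyclically: a
triangle would leave the two remaining vertices with at most one partner each. [folklore] -/
theorem cycle_of_two_regular {ι : Type*} [DecidableEq ι] (S : Finset ι) (R : ι → ι → Prop)
    [DecidableRel R] (hsymm : ∀ a b, R a b → R b a) (h5 : S.card = 5)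
    (h2 : ∀ l ∈ S, (S.filter fun l' => l' ≠ l ∧ R l l').card = 2) :
    ∃ w : Fin 5 → ι, Function.Injective w ∧ (∀ t, w t ∈ S) ∧ ∀ t, R (w t) (w (t + 1)) := by
  have hP : ∀ l ∈ S, ∃ a b, a ≠ b ∧ (S.filter fun l' => l' ≠ l ∧ R l l') = {a, b} :=
    fun l hl => Finset.card_eq_two.mp (h2 l hl)
  have hmemP : ∀ l r, r ∈ (S.filter fun l' => l' ≠ l ∧ R l l') ↔ r ∈ S ∧ r ≠ l ∧ R l r :=
    fun l r => Finset.mem_filter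
  have full : ∀ v a b, (S.filter fun l' => l' ≠ v ∧ R v l') = {a, b} →
      ∀ r ∈ S, r ≠ v → R v r → r = a ∨ r = b := by
    intro v a b hv r hr hrv hR
    have h : r ∈ (S.filter fun l' => l' ≠ v ∧ R v l') := (hmemP v r).mpr ⟨hr, hrv, hR⟩
    rwa [hv, Finset.mem_insert, Finset.mem_singleton] at h
  have part : ∀ v a b, (S.filter fun l' => l' ≠ v ∧ R v l') = {a, b} →
      (a ∈ S ∧ a ≠ v ∧ R v a) ∧ (b ∈ S ∧ b ≠ v ∧ R v b) := by
    intro v a b hv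
    exact ⟨(hmemP v a).mp (by rw [hv]; simp), (hmemP v b).mp (by rw [hv]; simp)⟩
  -- no room: a set `U ⊆ S` of `3` or `4` "saturated" vertices is impossible
  have noroom : ∀ U : Finset ι, U ⊆ S → 3 ≤ U.card → U.card ≤ 4 →
      (∀ r ∈ S, r ∉ U → ∀ p ∈ S, p ≠ r → R r p → p ∉ U) → False := by
    intro U hU h3 h4 havoid
    obtain ⟨r, hr⟩ : (S \ U).Nonempty := by
      rw [← Finset.card_pos, Finset.card_sdiff_of_subset hU, h5]
      omega
    rw [Finset.mem_sdiff] at hr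
    obtain ⟨hrS, hrU⟩ := hr
    obtain ⟨c, e, hce, hPr⟩ := hP r hrS
    obtain ⟨⟨hcS, hcr, Rrc⟩, ⟨heS, her, Rre⟩⟩ := part r c e hPr
    have hsub : ({c, e} : Finset ι) ⊆ S \ insert r U := by
      intro p hp
      rw [Finset.mem_insert, Finset.mem_singleton] at hp
      rw [Finset.mem_sdiff, Finset.mem_insert, not_or]
      rcases hp with rfl | rfl
      · exact ⟨hcS, hcr, havoid r hrS hrU _ hcS hcr Rrc⟩
      · exact ⟨heS, her, havoid r hrS hrU _ heS her Rre⟩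
    have hrU' : insert r U ⊆ S := Finset.insert_subset hrS hU
    have hcard := Finset.card_le_card hsub
    rw [Finset.card_pair hce, Finset.card_sdiff_of_subset hrU', h5,
      Finset.card_insert_of_notMem hrU] at hcard
    omega
  -- w₀ and its two partners w₁, w₄
  obtain ⟨w₀, hw₀⟩ : S.Nonempty := Finset.card_pos.mp (by omega)
  obtain ⟨w₁, w₄, h14, hP0⟩ := hP w₀ hw₀
  obtain ⟨⟨hw₁, h10, R01⟩, ⟨hw₄, h40, R04⟩⟩ := part w₀ w₁ w₄ hP0
  -- the other partner w₂ of w₁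
  obtain ⟨a, b, hab, hP1⟩ := hP w₁ hw₁
  obtain ⟨w₂, h20, hP1'⟩ : ∃ w₂, w₂ ≠ w₀ ∧ (S.filter fun l' => l' ≠ w₁ ∧ R w₁ l') = {w₀, w₂} := by
    rcases full w₁ a b hP1 w₀ hw₀ h10.symm (hsymm _ _ R01) with rfl | rfl
    · exact ⟨b, hab.symm, hP1⟩
    · exact ⟨a, hab, by rw [hP1, Finset.pair_comm]⟩
  obtain ⟨-, ⟨hw₂, h21, R12⟩⟩ := part w₁ w₀ w₂ hP1'
  -- the other partner w₃ of w₄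
  obtain ⟨a', b', hab', hP4⟩ := hP w₄ hw₄
  obtain ⟨w₃, h30, hP4'⟩ : ∃ w₃, w₃ ≠ w₀ ∧ (S.filter fun l' => l' ≠ w₄ ∧ R w₄ l') = {w₀, w₃} := by
    rcases full w₄ a' b' hP4 w₀ hw₀ h40.symm (hsymm _ _ R04) with rfl | rfl
    · exact ⟨b', hab'.symm, hP4⟩
    · exact ⟨a', hab', by rw [hP4, Finset.pair_comm]⟩
  obtain ⟨-, ⟨hw₃, h34, R43⟩⟩ := part w₄ w₀ w₃ hP4'
  -- no triangle `w₀ w₁ w₄`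
  have hn14 : ¬ R w₁ w₄ := by
    intro R14
    have h42 : w₄ = w₂ := by
      rcases full w₁ w₀ w₂ hP1' w₄ hw₄ h14.symm R14 with h | h
      · exact absurd h h40
      · exact h
    have h13 : w₁ = w₃ := by
      rcases full w₄ w₀ w₃ hP4' w₁ hw₁ h14 (hsymm _ _ R14) with h | h
      · exact absurd h h10
      · exact h
    have hn0 : w₀ ∉ ({w₁, w₄} : Finset ι) := by
      simp only [Finset.mem_insert, Finset.mem_singleton, not_or]
      exact ⟨h10.symm, h40.symm⟩
    have hc3 : ({w₀, w₁, w₄} : Finset ι).card = 3 := by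
      rw [Finset.card_insert_of_notMem hn0, Finset.card_pair h14]
    refine noroom {w₀, w₁, w₄} ?_ hc3.ge (by omega) ?_
    · intro p hp
      simp only [Finset.mem_insert, Finset.mem_singleton] at hp
      rcases hp with rfl | rfl | rfl <;> assumption
    · intro r hrS hrU p hpS hpr Rrp
      simp only [Finset.mem_insert, Finset.mem_singleton, not_or] at hrU ⊢
      obtain ⟨hr0, hr1, hr4⟩ := hrU
      refine ⟨?_, ?_, ?_⟩
      · rintro rfl
        rcases full _ w₁ w₄ hP0 r hrS hr0 (hsymm _ _ Rrp) with h | h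
        · exact hr1 h
        · exact hr4 h
      · rintro rfl
        rcases full _ w₀ w₂ hP1' r hrS hr1 (hsymm _ _ Rrp) with h | h
        · exact hr0 h
        · exact hr4 (h.trans h42.symm)
      · rintro rfl
        rcases full _ w₀ w₃ hP4' r hrS hr4 (hsymm _ _ Rrp) with h | h
        · exact hr0 h
        · exact hr1 (h.trans h13.symm)
  have h24 : w₂ ≠ w₄ := fun h => hn14 (h ▸ R12)
  have h31 : w₃ ≠ w₁ := fun h => hn14 (hsymm _ _ (h ▸ R43))
  -- `w₂ ≠ w₃`
  have h23 : w₂ ≠ w₃ := by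
    intro h32
    rw [← h32] at R43 hP4'
    -- partners of w₂ are exactly {w₁, w₄}
    obtain ⟨c, e, hce, hP2⟩ := hP w₂ hw₂
    have hP2' : (S.filter fun l' => l' ≠ w₂ ∧ R w₂ l') = {w₁, w₄} := by
      refine (Finset.eq_of_subset_of_card_le ?_ ?_).symm
      · intro p hp
        rw [Finset.mem_insert, Finset.mem_singleton] at hp
        rcases hp with rfl | rfl
        · exact (hmemP w₂ _).mpr ⟨hw₁, h21.symm, hsymm _ _ R12⟩
        · exact (hmemP w₂ _).mpr ⟨hw₄, h24.symm, hsymm _ _ R43⟩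
      · rw [h2 w₂ hw₂, Finset.card_pair h14]
    have hn1 : w₁ ∉ ({w₄, w₂} : Finset ι) := by
      simp only [Finset.mem_insert, Finset.mem_singleton, not_or]
      exact ⟨h14, h21.symm⟩
    have hn0 : w₀ ∉ ({w₁, w₄, w₂} : Finset ι) := by
      simp only [Finset.mem_insert, Finset.mem_singleton, not_or]
      exact ⟨h10.symm, h40.symm, h20.symm⟩
    have hc4 : ({w₀, w₁, w₄, w₂} : Finset ι).card = 4 := by
      rw [Finset.card_insert_of_notMem hn0, Finset.card_insert_of_notMem hn1,
        Finset.card_pair h24.symm]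
    refine noroom {w₀, w₁, w₄, w₂} ?_ (by omega) hc4.le ?_
    · intro p hp
      simp only [Finset.mem_insert, Finset.mem_singleton] at hp
      rcases hp with rfl | rfl | rfl | rfl <;> assumption
    · intro r hrS hrU p hpS hpr Rrp
      simp only [Finset.mem_insert, Finset.mem_singleton, not_or] at hrU ⊢
      obtain ⟨hr0, hr1, hr4, hr2⟩ := hrU
      refine ⟨?_, ?_, ?_, ?_⟩
      · rintro rfl
        rcases full _ w₁ w₄ hP0 r hrS hr0 (hsymm _ _ Rrp) with h | h
        · exact hr1 h
        · exact hr4 h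
      · rintro rfl
        rcases full _ w₀ w₂ hP1' r hrS hr1 (hsymm _ _ Rrp) with h | h
        · exact hr0 h
        · exact hr2 h
      · rintro rfl
        rcases full _ w₀ w₂ hP4' r hrS hr4 (hsymm _ _ Rrp) with h | h
        · exact hr0 h
        · exact hr2 h
      · rintro rfl
        rcases full _ w₁ w₄ hP2' r hrS hr2 (hsymm _ _ Rrp) with h | h
        · exact hr1 h
        · exact hr4 h
  -- `S = {w₀, w₁, w₂, w₃, w₄}`
  have hm2 : w₂ ∉ ({w₃, w₄} : Finset ι) := by
    simp only [Finset.mem_insert, Finset.mem_singleton, not_or]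
    exact ⟨h23, h24⟩
  have hm1 : w₁ ∉ ({w₂, w₃, w₄} : Finset ι) := by
    simp only [Finset.mem_insert, Finset.mem_singleton, not_or]
    exact ⟨h21.symm, h31.symm, h14⟩
  have hm0 : w₀ ∉ ({w₁, w₂, w₃, w₄} : Finset ι) := by
    simp only [Finset.mem_insert, Finset.mem_singleton, not_or]
    exact ⟨h10.symm, h20.symm, h30.symm, h40.symm⟩
  have hW : ({w₀, w₁, w₂, w₃, w₄} : Finset ι) = S := by
    apply Finset.eq_of_subset_of_card_le
    · intro p hp
      simp only [Finset.mem_insert, Finset.mem_singleton] at hp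
      rcases hp with rfl | rfl | rfl | rfl | rfl <;> assumption
    · rw [h5, Finset.card_insert_of_notMem hm0, Finset.card_insert_of_notMem hm1,
        Finset.card_insert_of_notMem hm2, Finset.card_pair h34]
  -- the remaining edge `w₂ w₃`
  have R23 : R w₂ w₃ := by
    obtain ⟨c, e, hce, hP2⟩ := hP w₂ hw₂
    obtain ⟨y, hy1, hP2'⟩ : ∃ y, y ≠ w₁ ∧ (S.filter fun l' => l' ≠ w₂ ∧ R w₂ l') = {w₁, y} := by
      rcases full w₂ c e hP2 w₁ hw₁ h21.symm (hsymm _ _ R12) with rfl | rfl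
      · exact ⟨e, hce.symm, hP2⟩
      · exact ⟨c, hce, by rw [hP2, Finset.pair_comm]⟩
    obtain ⟨-, ⟨hyS, hy2, R2y⟩⟩ := part w₂ w₁ y hP2'
    have hy0 : y ≠ w₀ := by
      rintro rfl
      rcases full _ w₁ w₄ hP0 w₂ hw₂ h20 (hsymm _ _ R2y) with h | h
      · exact h21 h
      · exact h24 h
    have hy4 : y ≠ w₄ := by
      rintro rfl
      rcases full _ w₀ w₃ hP4' w₂ hw₂ h24 (hsymm _ _ R2y) with h | h
      · exact h20 h
      · exact h23 h
    have hy : y ∈ ({w₀, w₁, w₂, w₃, w₄} : Finset ι) := by rw [hW]; exact hyS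
    simp only [Finset.mem_insert, Finset.mem_singleton] at hy
    rcases hy with h | h | h | h | h
    · exact absurd h hy0
    · exact absurd h hy1
    · exact absurd h hy2
    · rw [← h]; exact R2y
    · exact absurd h hy4
  refine ⟨![w₀, w₁, w₂, w₃, w₄], ?_, ?_, ?_⟩
  · intro s t h
    fin_cases s <;> fin_cases t <;> simp at h ⊢ <;>
      first
      | exact absurd h h10.symm | exact absurd h h10 | exact absurd h h20.symm | exact absurd h h20
      | exact absurd h h30.symm | exact absurd h h30 | exact absurd h h40.symm | exact absurd h h40
      | exact absurd h h21.symm | exact absurd h h21 | exact absurd h h31.symm | exact absurd h h31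
      | exact absurd h h14 | exact absurd h h14.symm | exact absurd h h23 | exact absurd h h23.symm
      | exact absurd h h24 | exact absurd h h24.symm | exact absurd h h34 | exact absurd h h34.symm
  · intro t
    fin_cases t <;> simp <;> assumption
  · intro t
    fin_cases t
    · exact R01
    · exact R12
    · exact R23
    · exact hsymm _ _ R43
    · exact hsymm _ _ R04

/-- **The closed five-ring, enumerated.**  Under the hypotheses of `fiveFold_ring_closed`
the five common neighbours of the bond `(j,k)` can be listed as `w 0, …, w 4` (injectively)
with consecutive ones bonded, `|x (w t) - x (w (t+1))| ≤ 1` cyclically: five tetrahedra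
`(j, k, w t, w (t+1))` with all edges in `[55/57, 1]` closing up around the bond. [folklore] -/
theorem fiveFold_ring_cycle {N : ℕ} (x : Fin N → EuclideanSpace ℝ (Fin 3)) (j k : Fin N)
    (hjk : j ≠ k) (hdjk : dist (x j) (x k) ≤ 1)
    (hsep : ∀ j' : Fin N, dist (x j) (x j') ≤ 11 / 10 → ∀ k' : Fin N, k' ≠ j' →
      (55 : ℝ) / 57 ≤ dist (x j') (x k'))
    (hgap : ∀ l l' : Fin N, dist (x j) (x l) ≤ 1 → dist (x j) (x l') ≤ 1 →
      1 < dist (x l) (x l') → (131 : ℝ) / 100 ≤ dist (x l) (x l'))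
    (h5 : (Finset.univ.filter fun l : Fin N =>
        l ≠ j ∧ l ≠ k ∧ dist (x j) (x l) ≤ 1 ∧ dist (x k) (x l) ≤ 1).card = 5) :
    ∃ w : Fin 5 → Fin N, Function.Injective w ∧
      (∀ t, w t ∈ (Finset.univ.filter fun l : Fin N =>
        l ≠ j ∧ l ≠ k ∧ dist (x j) (x l) ≤ 1 ∧ dist (x k) (x l) ≤ 1)) ∧
      ∀ t, dist (x (w t)) (x (w (t + 1))) ≤ 1 := by
  classical
  obtain ⟨w, hinj, hmem, hR⟩ := cycle_of_two_regular
    (Finset.univ.filter fun l : Fin N =>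
      l ≠ j ∧ l ≠ k ∧ dist (x j) (x l) ≤ 1 ∧ dist (x k) (x l) ≤ 1)
    (fun l l' => dist (x l) (x l') ≤ 1) (fun a b h => by rwa [dist_comm]) h5
    (fiveFold_ring_closed x j k hjk hdjk hsep hgap h5)
  exact ⟨w, hinj, hmem, hR⟩

/-- **The closed five-ring enumerated, in the vocabulary of `stub_fiveFoldSubcubic`.**  Under
the extended-gap hypothesis of the stub (verbatim), deep inside an all-Good `2D`-ball
(`D ≥ 5`), the five common neighbours of a five-fold bond `(j,k)` admit a cyclic enumeration
`w : Fin 5 → Fin N` with `|x (w t) - x (w (t+1))| ≤ 1`. [folklore] -/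
theorem fiveFold_ring_cycle_of_deep
    (hGap : ∀ (N : ℕ) (x : Fin N → EuclideanSpace ℝ (Fin 3)) (i j : Fin N),
      (∀ l : Fin N, dist (x i) (x l) ≤ 4 →
        ((∀ j' : Fin N, dist (x l) (x j') ≤ 11 / 10 → ∀ k : Fin N, k ≠ j' →
            (55 : ℝ) / 57 ≤ dist (x j') (x k)) ∧
          (Finset.univ.filter fun j' : Fin N => j' ≠ l ∧ dist (x l) (x j') ≤ 1).card = 12 ∧
          (Finset.univ.filter fun j' : Fin N => j' ≠ l ∧ dist (x l) (x j') ≤ 11 / 10).card ≤ 12)) →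
      1 < dist (x i) (x j) → (131 : ℝ) / 100 ≤ dist (x i) (x j))
    {N : ℕ} (x : Fin N → EuclideanSpace ℝ (Fin 3)) (i : Fin N) (D : ℝ) (hD : 5 ≤ D)
    (hGood : ∀ j : Fin N, dist (x i) (x j) ≤ 2 * D →
        ((∀ j' : Fin N, dist (x j) (x j') ≤ 11 / 10 → ∀ k : Fin N, k ≠ j' →
            (55 : ℝ) / 57 ≤ dist (x j') (x k)) ∧
          (Finset.univ.filter fun j' : Fin N => j' ≠ j ∧ dist (x j) (x j') ≤ 1).card = 12 ∧
          (Finset.univ.filter fun j' : Fin N => j' ≠ j ∧ dist (x j) (x j') ≤ 11 / 10).card ≤ 12))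
    (j k : Fin N) (hij : dist (x i) (x j) ≤ D) (hjk : j ≠ k) (hdjk : dist (x j) (x k) ≤ 1)
    (h5 : (Finset.univ.filter fun l : Fin N =>
        l ≠ j ∧ l ≠ k ∧ dist (x j) (x l) ≤ 1 ∧ dist (x k) (x l) ≤ 1).card = 5) :
    ∃ w : Fin 5 → Fin N, Function.Injective w ∧
      (∀ t, w t ∈ (Finset.univ.filter fun l : Fin N =>
        l ≠ j ∧ l ≠ k ∧ dist (x j) (x l) ≤ 1 ∧ dist (x k) (x l) ≤ 1)) ∧
      ∀ t, dist (x (w t)) (x (w (t + 1))) ≤ 1 := by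
  have hsep := (hGood j (by linarith)).1
  refine fiveFold_ring_cycle x j k hjk hdjk hsep ?_ h5
  intro l l' hjl _ hgt
  refine hGap N x l l' (fun l'' h4 => hGood l'' ?_) hgt
  calc dist (x i) (x l'') ≤ dist (x i) (x j) + dist (x j) (x l) + dist (x l) (x l'') :=
        dist_triangle4 _ _ _ _
    _ ≤ 2 * D := by linarith


/-- Registered closed form of `fiveFold_ring_cycle_of_deep` (S2α of line `Sketch`, cyclic
enumeration): under the extended gap, in an all-Good `2D`-ball (`D ≥ 5`) the five common
neighbours of a five-fold bond admit an injective enumeration `w : Fin 5 → Fin N` with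
consecutive members bonded. [folklore] -/
theorem stub_fiveFoldRingCycle :
    (∀ (N : ℕ) (x : Fin N → EuclideanSpace ℝ (Fin 3)) (i j : Fin N),
      (∀ l : Fin N, dist (x i) (x l) ≤ 4 →
        ((∀ j' : Fin N, dist (x l) (x j') ≤ 11 / 10 → ∀ k : Fin N, k ≠ j' →
            (55 : ℝ) / 57 ≤ dist (x j') (x k)) ∧
          (Finset.univ.filter fun j' : Fin N => j' ≠ l ∧ dist (x l) (x j') ≤ 1).card = 12 ∧
          (Finset.univ.filter fun j' : Fin N => j' ≠ l ∧ dist (x l) (x j') ≤ 11 / 10).card ≤ 12)) →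
      1 < dist (x i) (x j) → (131 : ℝ) / 100 ≤ dist (x i) (x j)) →
    ∀ (N : ℕ) (x : Fin N → EuclideanSpace ℝ (Fin 3)) (i : Fin N) (D : ℝ), 5 ≤ D →
    (∀ j : Fin N, dist (x i) (x j) ≤ 2 * D →
        ((∀ j' : Fin N, dist (x j) (x j') ≤ 11 / 10 → ∀ k : Fin N, k ≠ j' →
            (55 : ℝ) / 57 ≤ dist (x j') (x k)) ∧
          (Finset.univ.filter fun j' : Fin N => j' ≠ j ∧ dist (x j) (x j') ≤ 1).card = 12 ∧
          (Finset.univ.filter fun j' : Fin N => j' ≠ j ∧ dist (x j) (x j') ≤ 11 / 10).card ≤ 12)) →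
    ∀ (j k : Fin N), dist (x i) (x j) ≤ D → j ≠ k → dist (x j) (x k) ≤ 1 →
    (Finset.univ.filter fun l : Fin N =>
        l ≠ j ∧ l ≠ k ∧ dist (x j) (x l) ≤ 1 ∧ dist (x k) (x l) ≤ 1).card = 5 →
    ∃ w : Fin 5 → Fin N, Function.Injective w ∧ (∀ t, w t ∈ (Finset.univ.filter fun l : Fin N =>
        l ≠ j ∧ l ≠ k ∧ dist (x j) (x l) ≤ 1 ∧ dist (x k) (x l) ≤ 1)) ∧
      ∀ t, dist (x (w t)) (x (w (t + 1))) ≤ 1 :=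
  fun hGap _ x i D hD hGood j k hij hjk hdjk h5 =>
    fiveFold_ring_cycle_of_deep hGap x i D hD hGood j k hij hjk hdjk h5

end Summit.AtomisticToContinuum.Crystallization.Theorems.SquareWellLayerCakeGapTwelveToBarlow

end
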